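import Mathlib
import Summits.AtomisticToContinuum.Crystallization.Theorems.BraggSlacknessRigidityHcpDiffractionRigidityEssentialPeriodicityRatAux4
import Summits.AtomisticToContinuum.Crystallization.Theorems.BraggSlacknessRigidityHcpDiffractionRigidityEssentialPeriodicityOfArith

/-!
# Essential periodicity from a quiet spectrum on a commensurate lattice (stub
# `stub_essentialPeriodicityRat` of crux `HcpDiffractionRigidity`, item `stmt-AtomisticToContinuum-13166`)

Registered stub B2b of the skeleton, commensurate case `h² = q a²`: a `δ`-separated `Λ ∋ 0` inside
a full-rank discrete `ℤ`-module `M` with `a²`-rational Gram matrix (`D⟨u,v⟩ ∈ a²ℤ`), Gaussian-quiet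
off the Bragg set of the hcp template along scales `L t → ∞`, is ESSENTIALLY PERIODIC under a
finite-index submodule `M' = k • M`.  Assembly of the generic theorem
`stub_essentialPeriodicityOfArith` (Aux files 6–7) with the periods `V = (D/a²) M` of `|S_t|²`
and the arithmetic lemma `stub_essentialPeriodicityRatArith` (Aux file 4), `k = 2D · 12 num(q)`.

All `[folklore]`.
-/

noncomputable section

namespace Summit.AtomisticToContinuum.Crystallization.Theorems

open Filter
open scoped RealInnerProductSpace Classical
open Literature.MathematicalPhysics.StatisticalMechanics

/-- **Registered stub B2b of the skeleton: essential periodicity from a quiet spectrum on a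
commensurate lattice.** For the hcp template with `h² = q a²`, a `δ`-separated `Λ ∋ 0` inside a
full-rank discrete `ℤ`-module `M` with `D⟨u, v⟩ ∈ a²ℤ` on `M`, Gaussian-quiet (per squared
Gaussian mass) off `{0} ∪` the Bragg spheres along scales `L t → ∞`, is essentially periodic
under a finite-index submodule `M'` of `M`: for every `z ∈ M'` the squared-Gaussian mass of the
points `s ∈ Λ` with `s + z ∉ Λ` is `o(`total squared-Gaussian mass`)`.  (Periods `V = (D/a²)M`
of `|S_t|²`; arithmetic lemma of Aux file 4 with `k = 2D · 12 num(q)`; generic theorem of Aux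
file 7 with the same scales.) [folklore] -/
theorem stub_essentialPeriodicityRat : ∀ (a h : ℝ) (ha : a ≠ 0) (hh : h ≠ 0), (∃ q : ℚ, h ^ 2 = (q : ℝ) * a ^ 2) → ∀ δ : ℝ, 0 < δ → ∀ Λ : Set (EuclideanSpace ℝ (Fin 3)), (∀ p ∈ Λ, ∀ q ∈ Λ, p ≠ q → δ ≤ dist p q) → (0 : EuclideanSpace ℝ (Fin 3)) ∈ Λ → ∀ M : Submodule ℤ (EuclideanSpace ℝ (Fin 3)), DiscreteTopology M → Submodule.span ℝ (M : Set (EuclideanSpace ℝ (Fin 3))) = ⊤ → (∃ D : ℕ, 0 < D ∧ ∀ u ∈ M, ∀ v ∈ M, ∃ n : ℤ, (D : ℝ) * inner ℝ u v = (n : ℝ) * a ^ 2) → Λ ⊆ M → (∃ L : ℕ → ℝ, Filter.Tendsto L Filter.atTop Filter.atTop ∧ ∀ g : EuclideanSpace ℝ (Fin 3) → ℝ, Continuous g → HasCompactSupport g → (∀ ξ ∈ tsupport g, ξ ≠ 0 ∧ ∀ k : EuclideanSpace ℝ (Fin 3), (∀ v ∈ (Literature.MathematicalPhysics.StatisticalMechanics.hcpPeriodicConfiguration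 ha hh).lattice, ∃ n : ℤ, inner ℝ k v = (n : ℝ)) → ‖ξ‖ ≠ ‖k‖) → ∀ ε : ℝ, 0 < ε → ∀ᶠ t : ℕ in Filter.atTop, (∫ ξ, g ξ * ‖∑' s : Λ, (Real.exp (-(‖(s : EuclideanSpace ℝ (Fin 3))‖ ^ 2) / L t ^ 2) : ℂ) * Complex.exp (2 * Real.pi * Complex.I * (inner ℝ ξ (s : EuclideanSpace ℝ (Fin 3)) : ℂ))‖ ^ 2) ≤ ε * ∑' s : Λ, Real.exp (-(‖(s : EuclideanSpace ℝ (Fin 3))‖ ^ 2) / L t ^ 2) ^ 2) → ∃ (M' : Submodule ℤ (EuclideanSpace ℝ (Fin 3))) (k : ℕ), 0 < k ∧ M' ≤ M ∧ (∀ z ∈ M, (k : ℤ) • z ∈ M') ∧ (∃ L' : ℕ → ℝ, Filter.Tendsto L' Filter.atTop Filter.atTop ∧ ∀ z ∈ M', Filter.Tendsto (fun t : ℕ => (∑' s : Λ, if (s : EuclideanSpace ℝ (Fin 3)) + z ∈ Λ then (0 : ℝ) else Real.exp (-(‖(s : EuclideanSpace ℝ (Fin 3))‖ ^ 2) / L'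 t ^ 2) ^ 2) / ∑' s : Λ, Real.exp (-(‖(s : EuclideanSpace ℝ (Fin 3))‖ ^ 2) / L' t ^ 2) ^ 2) Filter.atTop (nhds 0)) := by
  intro a h ha hh hq δ hδ Λ hsep _h0 M hMd _hMspan hMgram hΛM hQ
  obtain ⟨q, hq⟩ := hq
  obtain ⟨D, hD, hMD⟩ := hMgram
  obtain ⟨L, hL, hquiet⟩ := hQ
  haveI := hMd
  have ha2 : a ^ 2 ≠ 0 := pow_ne_zero 2 ha
  -- the periods `V = (D/a²) M` of `|S_t|²`
  obtain ⟨V, hVdef⟩ : ∃ V : Set (EuclideanSpace ℝ (Fin 3)),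
      V = {m | ∃ b ∈ M, m = ((D : ℝ) / a ^ 2) • b} := ⟨_, rfl⟩
  have hV : ∀ m ∈ V, ∀ s ∈ Λ, ∃ n : ℤ, ⟪m, s⟫ = (n : ℝ) := by
    intro m hm s hs
    rw [hVdef] at hm
    obtain ⟨b, hb, rfl⟩ := hm
    obtain ⟨n, hn⟩ := hMD b hb s (hΛM hs)
    refine ⟨n, ?_⟩
    rw [real_inner_smul_left]
    field_simp
    linear_combination hn
  -- the arithmetic lemma with `k = 2D · 12 num(q)`
  have hq0 : (0 : ℚ) < q := by
    have h1 : (0 : ℝ) < h ^ 2 := by positivity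
    have h2 : (0 : ℝ) < a ^ 2 := by positivity
    rw [hq] at h1
    exact_mod_cast pos_of_mul_pos_left h1 h2.le
  have hnum : 0 < q.num := Rat.num_pos.2 hq0
  have hk : 0 < 2 * D * (12 * q.num.toNat) := by
    have : 0 < q.num.toNat := by omega
    positivity
  have harith : ∀ ξ : EuclideanSpace ℝ (Fin 3), (∀ m ∈ V, ¬ (ξ + m ≠ 0 ∧
      ∀ k' : EuclideanSpace ℝ (Fin 3), (∀ v ∈ (hcpPeriodicConfiguration ha hh).lattice,
        ∃ n : ℤ, ⟪k', v⟫ = (n : ℝ)) → ‖ξ + m‖ ≠ ‖k'‖)) →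
      ∀ z ∈ M, ∃ n : ℤ, ((2 * D * (12 * q.num.toNat) : ℕ) : ℝ) * ⟪ξ, z⟫ = (n : ℝ) := by
    intro ξ hξ z hz
    refine stub_essentialPeriodicityRatArith a h ha hh q hq M D hD hMD ξ (fun b hb => ?_) z hz
    exact hξ _ (by rw [hVdef]; exact ⟨b, hb, rfl⟩)
  obtain ⟨M', k', hk', hM'M, hkM, hess⟩ := stub_essentialPeriodicityOfArith _ δ hδ Λ hsep M hMd
    hΛM L hL hquiet V hV _ hk harith
  exact ⟨M', k', hk', hM'M, hkM, L, hL, hess⟩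

end Summit.AtomisticToContinuum.Crystallization.Theorems

end
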